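import Literature.NumberTheory.Automorphic.IdeleClassBaseChangeClosed
import HarnessLib

/-!
# The norm identity for the base change of idèle classes: `‖ι c‖_L = ‖c‖_K ^ [L : K]`

Topic `NumberTheory/Automorphic`; namespace `Literature.NumberTheory.Automorphic`. Everything here is proved.

For a finite extension of number fields `L/K` and `ι = classBaseChange K L : C_K →* C_L`:

* `continuous_classNorm` — the class-group norm `‖·‖ : C_K →* ℝ≥0` (`IdeleClassGroup.norm`) is continuous
  (from `continuous_ideleNorm_holds`);
* `norm_classBaseChange_of_mem_normOne` — `‖ι c₁‖_L = 1` for `c₁ ∈ C_K¹`: `‖·‖_L ∘ ι` is a continuous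
  homomorphism on the COMPACT group `C_K¹` (`IdeleClassGroup.isCompact_normOne_holds`, Cassels–Fröhlich II §16)
  with values in `ℝ_{>0}`, and a bounded subgroup of `ℝ_{>0}` is trivial;
* `norm_classBaseChange` — **`‖ι c‖_L = ‖c‖_K ^ [L : K]`** for every idèle class `c`: write `c = c₁ · [z_K(r)]`
  (`IdeleClassGroup.exists_normOne_mul_posRealIdele`); `ι [z_K(r)] = [z_L(r)]` (`classBaseChange_posRealIdele`),
  `‖z_K(r)‖ = r^{[K:ℚ]}`, `‖z_L(r)‖ = r^{[L:ℚ]}` (`ideleNorm_posRealIdele_holds`) and `[L:ℚ] = [K:ℚ]·[L:K]`.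
  This is the idèle-class form of `|x|_L = |x|_K^{[L:K]}` for `x ∈ 𝕀_K ⊆ 𝕀_L` (Cassels–Fröhlich, Ch. II §11:
  `∏_{w ∣ v} |x|_w = |x|_v^{[L:K]}`), obtained here WITHOUT the local degree bookkeeping `∑_{w∣v} [L_w:K_v] = [L:K]`.

Provenance: the argument of the `pub-hodgecm` package theorem `NumberField.logClassNorm_classBaseChange'`
(`HodgeCM/Literature/ClassBaseChange.lean`, gen 5: "`|·|_L = |·|²_{L₀}`" of PerL v5 §3.2 l. 311), re-proved over the
tree's `IdeleClassGroup`.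

## References

* J. W. S. Cassels, A. Fröhlich (eds.), *Algebraic Number Theory* (1967), Ch. II (Cassels) §11 (normalised
  absolute values in extensions), §16 (compactness of `J¹/k^×`). [CasselsFrohlichANT1967]
* A. Weil, *Basic Number Theory*, Ch. IV §4 (the module of an idèle). [WeilBNT1967]
-/

noncomputable section

open NumberField
open scoped NNReal

namespace Literature.NumberTheory.Automorphic

variable (K L : Type) [Field K] [Field L] [Algebra K L] [NumberField K] [NumberField L]

/-- The class-group norm `‖·‖ : C_K →* ℝ≥0` is continuous. [folklore] -/
theorem continuous_classNorm : Continuous (IdeleClassGroup.norm K) :=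
  (QuotientGroup.isQuotientMap_mk (GaloisRepresentations.principalIdeles K)).continuous_iff.mpr
    (continuous_ideleNorm_holds K)

/-- A continuous homomorphism from a compact group to `ℝ≥0` with non-zero values is trivial (a bounded subgroup
of `ℝ_{>0}` is `{1}`). [folklore] -/
theorem eq_one_of_isCompact_of_ne_zero {G : Type*} [Group G] [TopologicalSpace G] [CompactSpace G]
    (φ : G →* ℝ≥0) (hφ : Continuous φ) (hne : ∀ g, φ g ≠ 0) (g : G) : φ g = 1 := by
  obtain ⟨B, hB⟩ := (isCompact_univ.image hφ).bddAbove
  have hbound : ∀ w, (φ w : ℝ) ≤ B := fun w => by exact_mod_cast hB ⟨w, Set.mem_univ _, rfl⟩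
  have hle : ∀ w, (φ w : ℝ) ≤ 1 := by
    intro w
    by_contra hlt
    rw [not_le] at hlt
    obtain ⟨k, hk⟩ := pow_unbounded_of_one_lt (B : ℝ) hlt
    have := hbound (w ^ k)
    rw [map_pow, NNReal.coe_pow] at this
    exact absurd (hk.trans_le this) (lt_irrefl _)
  have hinv : (φ g⁻¹ : ℝ) = (φ g : ℝ)⁻¹ := by
    have h1 : φ g⁻¹ * φ g = 1 := by rw [← map_mul, inv_mul_cancel, map_one]
    exact_mod_cast eq_inv_of_mul_eq_one_left h1
  have h1 := hle g
  have h2 := hle g⁻¹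
  rw [hinv] at h2
  have hpos : (0 : ℝ) < φ g := NNReal.coe_pos.2 (pos_iff_ne_zero.2 (hne g))
  have h3 : (1 : ℝ) ≤ φ g := by rwa [inv_le_one₀ hpos] at h2
  exact_mod_cast le_antisymm h1 h3

/-- **`‖ι c₁‖_L = 1` on `C_K¹`**: the norm of the base change of a norm-one class is `1` (compactness of
`C_K¹`). [cite: CasselsFrohlichANT1967, Ch. II §16] -/
theorem norm_classBaseChange_of_mem_normOne {c : IdeleClassGroup K} (hc : c ∈ IdeleClassGroup.normOne K) :
    IdeleClassGroup.norm L (classBaseChange K L c) = 1 := by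
  haveI : CompactSpace (IdeleClassGroup.normOne K) :=
    isCompact_iff_compactSpace.mp (IdeleClassGroup.isCompact_normOne_holds K)
  let φ : IdeleClassGroup.normOne K →* ℝ≥0 :=
    ((IdeleClassGroup.norm L).comp (classBaseChange K L)).comp (IdeleClassGroup.normOne K).subtype
  have hφ : Continuous φ :=
    ((continuous_classNorm L).comp (continuous_classBaseChange K L)).comp continuous_subtype_val
  have hne : ∀ g, φ g ≠ 0 := fun g => by
    change IdeleClassGroup.norm L (classBaseChange K L (g : IdeleClassGroup K)) ≠ 0
    induction (g : IdeleClassGroup K) using QuotientGroup.induction_on with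
    | H x => rw [classBaseChange_mk, IdeleClassGroup.norm_mk]; exact ideleNorm_ne_zero _
  exact eq_one_of_isCompact_of_ne_zero φ hφ hne ⟨c, hc⟩

/-- **The norm identity `‖ι c‖_L = ‖c‖_K ^ [L : K]`** for the base change of idèle classes.
[cite: CasselsFrohlichANT1967, Ch. II §11] -/
theorem norm_classBaseChange (c : IdeleClassGroup K) :
    IdeleClassGroup.norm L (classBaseChange K L c) = IdeleClassGroup.norm K c ^ Module.finrank K L := by
  obtain ⟨c₁, hc₁, r, rfl⟩ := IdeleClassGroup.exists_normOne_mul_posRealIdele K c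
  have h1 : IdeleClassGroup.norm K c₁ = 1 := IdeleClassGroup.mem_normOne_iff.mp hc₁
  have hK : IdeleClassGroup.ideleNorm K (posRealIdele K r) = (r : ℝ≥0) ^ Module.finrank ℚ K :=
    ideleNorm_posRealIdele_holds K r
  have hL : IdeleClassGroup.ideleNorm L (posRealIdele L r) = (r : ℝ≥0) ^ Module.finrank ℚ L :=
    ideleNorm_posRealIdele_holds L r
  have lhs : IdeleClassGroup.norm L (classBaseChange K L
      (c₁ * ((posRealIdele K r : GaloisRepresentations.ideleGroup K) : IdeleClassGroup K))) =
      (r : ℝ≥0) ^ Module.finrank ℚ L := by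
    rw [map_mul, map_mul, norm_classBaseChange_of_mem_normOne K L hc₁, classBaseChange_posRealIdele,
      IdeleClassGroup.norm_mk, hL, one_mul]
  have rhs : IdeleClassGroup.norm K (c₁ * ((posRealIdele K r : GaloisRepresentations.ideleGroup K) : IdeleClassGroup K)) =
      (r : ℝ≥0) ^ Module.finrank ℚ K := by
    rw [map_mul, h1, IdeleClassGroup.norm_mk, hK, one_mul]
  rw [lhs, rhs, ← pow_mul, Module.finrank_mul_finrank ℚ K L]

/-- `ι` maps `C_K¹` into `C_L¹`. [cite: CasselsFrohlichANT1967, Ch. II §16] -/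
theorem classBaseChange_mem_normOne {c : IdeleClassGroup K} (hc : c ∈ IdeleClassGroup.normOne K) :
    classBaseChange K L c ∈ IdeleClassGroup.normOne L :=
  IdeleClassGroup.mem_normOne_iff.mpr (norm_classBaseChange_of_mem_normOne K L hc)

end Literature.NumberTheory.Automorphic

end
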